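import Literature.AnabelianGeometry.AbsoluteAnabelian.GaloisCyclotomeTateModule
import Literature.NumberTheory.GaloisRepresentations.TateModuleKummerCompletion
import Literature.NumberTheory.GaloisRepresentations.LocalReciprocity
import HarnessLib

/-!
# [AbsTopIII] Cor. 1.10 (ii)(d) STRENGTHENED — the Kummer image of `k^×` in the REAL container
# `H¹(G_k, μ_Ẑ(G_k))`, and (i)(b) as a NATURAL isomorphism (statements; proofs in the sibling files)

Mochizuki, *Topics in Absolute Anabelian Geometry III*, §1 Cor. 1.10 pp. 41–43 (manuscript pagination,
lit key `paper:url-5493eb38cbb7`):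

* (i)(b) p. 42: «By applying the isomorphism of (a) [and the cup-product in group cohomology], one
  constructs the surjection `H¹(G_k, μ_Ẑ(G_k)) ⥲ G_k^ab ↠ G^unr ⥲ Ẑ` determined by the Frobenius
  element … via the "group-theoretic" algorithm …  Here, the asserted "functoriality" is with respect to
  arbitrary injective open homomorphisms of profinite groups»;
* (ii)(d) pp. 42–43: «One constructs the image of the Kummer map `k^× ↪ H¹(G_k, μ_Ẑ(Π_X)) ↪ …` as
  the inverse image of the subgroup generated by the Frobenius element via the surjection
  `H¹(G_k, μ_Ẑ(Π_X)) ⥲ H¹(G_k, μ_Ẑ(G_k)) ⥲ G_k^ab ↠ Ẑ` of (b)».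

WHY THIS FILE (abc-iut layer L4, row «Cor110ii-PRIME», L4-lead RULINGS #5g (2) / #5i (1) / #5j (1)).
abc-iut-L4-t1 typed (ii)(d) relative to a model as `AbsTopIII.Cor_1_10_ii M` (`Reconstruction.lean`):
SOME algorithm outputs, on a curve over an MLF `k`, an abstract group `kummerBase.range ≃* k^×`.  That
Prop is PROVED (abc-iut-L4-d3 / w5-d036, `ReconstructionCor110iiWitness.lean`) but is TYPED-WEAK: it is
closable by a choice per isomorphism class of `G_k` ([AbsAnab] Prop. 1.2.1 (iii)) and its Kummer
container is not cohomology.  abc-iut-L4-t11 then made (i)(b) a THEOREM over the REAL container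
(`AbsTopIII.cor_1_10_i_b_holds`: `Nonempty (H¹(G_k, μ_Ẑ(G_k)) ≃+ G_k^ab)`, `GaloisCyclotomeH1Proofs.lean`).
The present STATEMENTS file types the printed content that the `Nonempty`/choice forms do not carry:

* `kummerTate k : kˣ →* Multiplicative H¹_cont(G_k, Ẑ(1)(k̄))` — THE Kummer map with
  `Ẑ(1)`-coefficients (a real definition: the unique continuous cohomology class whose projections to
  every finite level `n` are the tree's Kummer classes `kummerMap k n a ∈ H¹(G_k, μ_n)`; uniqueness is
  NSW II §7 Thm. 2.7.5 in degree `1`, tree `DiscreteInvSystem.toCohomologyLimit₁_injective`);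
* `galCyclotomeResHom α` / `galCyclotomeH1Map α` — `H¹(α; μ_Ẑ(α)) : H¹(G, μ_Ẑ(G)) → H¹(G', μ_Ẑ(G'))`,
  the map induced on the cohomology of abc-iut-L4-t1's GROUP-THEORETIC cyclotome by an ARBITRARY
  isomorphism of topological groups `α : G ≃ₜ* G'` (coefficients transported by `μ_Ẑ(α) = muZhat.congr α`);
* READING (D) `AbsTopIII.Cor_1_10_ii'` — for every MLF `k` (valued form) and EVERY `G_k`-equivariant
  identification `φ : μ_{ℚ/ℤ}(G_k) ≅ μ(k̄)` ([AbsAnab] Prop. 1.2.1 (vi), the discharged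
  `MLFGaloisCyclotomeIsRootsOfUnity`), there is `j : H¹(G_k, μ_Ẑ(G_k)) ≃+ G_k^ab` such that the composite
  `kˣ —κ̂→ H¹(G_k, Ẑ(1)) —H¹(φ)⁻¹→ H¹(G_k, μ_Ẑ(G_k)) —j→ G_k^ab` IS a local reciprocity map
  (`IsLocalReciprocityMap`: injective, image `𝔄_k⁰` = the Frobenius-integral part = «the inverse image
  of the subgroup generated by the Frobenius element», `𝒪_kˣ` onto the inertia image homeomorphically,
  uniformisers to arithmetic Frobenius).  This pins `j` on the Kummer image and makes print's
  sentence (d) a theorem: the Kummer image of `kˣ` in the real container is `j⁻¹(𝔄_k⁰)`;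
* READING (N) `AbsTopIII.Cor_1_10_i_b_natural` — «functorial "group-theoretic" algorithm» for (i)(b) in
  the cell's bi-anabelian (U)-shape (plan/L4/ASSIGNMENTS.md §2 ruling θ): ONE family
  `j_k : H¹(G_k, μ_Ẑ(G_k)) ≃+ G_k^ab` (MLFs `k : Type`), each member Kummer/reciprocity-compatible as in
  (D), such that for EVERY isomorphism of topological groups `α : G_{k₁} ≃ₜ* G_{k₂}` — geometric or not
  ([AbsTopIII] Rmk. 1.9.4: non-geometric ones exist) — `j_{k₂} ∘ H¹(α; μ_Ẑ(α)) = α^ab ∘ j_{k₁}`.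

Neither is closable by choice: (D) forces `j` to restrict to Artin reciprocity on a copy of `kˣ` inside
the cohomology of the group-theoretic cyclotome; (N) quantifies over all abstract automorphisms of `G_k`.
NOT typed here: the `Π_X`-level container `H¹(Π_X, μ_Ẑ(Π_X))` and the synchronization (c)
`μ_Ẑ(G_k) ⥲ μ_Ẑ(Π_X)` (FACT-LIST F-0348, campaign-L), functoriality in open injections «up to the index»
(Rmk. 1.10.1).  Statements only (definitions with bodies + `Prop`s); the proofs
(`cor_1_10_ii'_holds`, `cor_1_10_i_b_natural_holds`) live in proof-only companions.  abc-iut-L4-d1.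
HONEST FRAMING: [AbsTopIII] §1 is refereed, undisputed material (classical local class field theory and
Kummer theory); nothing here bears on [IUTchIII] Cor. 3.12 or takes a side; typed ≠ proved.
-/

noncomputable section

open CategoryTheory Function
open Field ValuativeRel

universe u

namespace Literature.AnabelianGeometry.AbsoluteAnabelian

open _root_.TopRep _root_.ContRepresentation _root_.ContinuousCohomology
open Literature.NumberTheory.GaloisRepresentations
open Literature.NumberTheory.GaloisRepresentations.DiscreteGaloisModule

/-! ### The Kummer map with `Ẑ(1)`-coefficients -/

section KummerTate

variable (k : Type u) [Field k] [CharZero k]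

/-- The family of Kummer classes `(δ_n(a))_{n ≥ 1} ∈ lim_n H¹(G_k, μ_n(k̄))` of `a ∈ kˣ` — compatible
along the power maps `μ_m ↠ μ_n` (tree `kummerMap_red_compat`; Cor. 1.10 (ii)(d) «the Kummer map»).
[cite: MochizukiAbsTopIII2015, Cor 1.10 (ii) p.42] -/
def kummerFamily (a : kˣ) : (muSystem k).cohomologyLimit 1 :=
  ⟨fun n => Multiplicative.toAdd (kummerMap k n a), fun _ _ h => kummerMap_red_compat k h a⟩

/-- Coordinates of `kummerFamily`. [cite: MochizukiAbsTopIII2015, Cor 1.10 (ii) p.42] -/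
@[simp] theorem coe_kummerFamily_apply (a : kˣ) (n : ℕ+) :
    ((kummerFamily k a : (muSystem k).cohomologyLimit 1) :
        ∀ n, continuousCohomology 1 ((muSystem k).ρ n).toTopRep) n =
      Multiplicative.toAdd (kummerMap k n a) :=
  rfl

/-- `kummerFamily` is multiplicative-to-additive. [cite: MochizukiAbsTopIII2015, Cor 1.10 (ii) p.42] -/
theorem kummerFamily_mul (a b : kˣ) : kummerFamily k (a * b) = kummerFamily k a + kummerFamily k b := by
  refine Subtype.ext (funext fun n => ?_)
  rw [AddSubgroup.coe_add, Pi.add_apply, coe_kummerFamily_apply, coe_kummerFamily_apply,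
    coe_kummerFamily_apply, map_mul, toAdd_mul]

/-- **The Kummer map with `Ẑ(1)`-coefficients** `κ̂ : kˣ → H¹_cont(G_k, Ẑ(1)(k̄))`,
`Ẑ(1)(k̄) = lim_n μ_n(k̄)` (`tateModuleMu`): `κ̂(a)` is the unique continuous cohomology class whose
image in `H¹(G_k, μ_n)` is the Kummer class `δ_n(a)` for every `n ≥ 1` (existence and uniqueness:
`H¹_cont(G_k, Ẑ(1)) ≃ lim_n H¹(G_k, μ_n)`, NSW II §7 Thm. 2.7.5 in degree `1`, tree
`continuousCohomologyOneTateModuleEquiv`) — Cor. 1.10 (ii)(d) «the Kummer map `k^× ↪ H¹(G_k, …)`».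
[cite: MochizukiAbsTopIII2015, Cor 1.10 (ii) p.42] -/
def kummerTate : kˣ →* Multiplicative (continuousCohomology 1 (tateModuleMu k).toTopRep) :=
  MonoidHom.mk' (fun a => Multiplicative.ofAdd ((continuousCohomologyOneTateModuleEquiv k).symm
    (kummerFamily k a))) fun a b => by
      rw [kummerFamily_mul, map_add, ofAdd_add]

/-- Defining property of `kummerTate`: its projection to level `n` is the Kummer class `δ_n(a)`.
[cite: MochizukiAbsTopIII2015, Cor 1.10 (ii) p.42] -/
theorem cohomologyMap_projHom_kummerTate (a : kˣ) (n : ℕ+) :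
    cohomologyMap ((muSystem k).projHom n) 1 (Multiplicative.toAdd (kummerTate k a)) =
      Multiplicative.toAdd (kummerMap k n a) := by
  have h := congrArg (fun x : (muSystem k).cohomologyLimit 1 =>
    (x : ∀ n, continuousCohomology 1 ((muSystem k).ρ n).toTopRep) n)
    ((continuousCohomologyOneTateModuleEquiv k).apply_symm_apply (kummerFamily k a))
  simpa only [kummerTate, MonoidHom.mk'_apply, toAdd_ofAdd, continuousCohomologyOneTateModuleEquiv,
    DiscreteInvSystem.coe_continuousCohomologyOneLimitEquiv_apply, coe_kummerFamily_apply] using h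

/-- `continuousCohomologyOneTateModuleEquiv` carries `κ̂(a)` to the family of Kummer classes.
[cite: MochizukiAbsTopIII2015, Cor 1.10 (ii) p.42] -/
@[simp] theorem continuousCohomologyOneTateModuleEquiv_kummerTate (a : kˣ) :
    continuousCohomologyOneTateModuleEquiv k (Multiplicative.toAdd (kummerTate k a)) = kummerFamily k a := by
  rw [kummerTate, MonoidHom.mk'_apply, toAdd_ofAdd, AddEquiv.apply_symm_apply]

/-- Uniqueness: a class of `H¹_cont(G_k, Ẑ(1))` projecting to `δ_n(a)` at every level IS `κ̂(a)`.
[cite: MochizukiAbsTopIII2015, Cor 1.10 (ii) p.42] -/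
theorem eq_kummerTate_of_proj (a : kˣ) (x : continuousCohomology 1 (tateModuleMu k).toTopRep)
    (h : ∀ n : ℕ+, cohomologyMap ((muSystem k).projHom n) 1 x = Multiplicative.toAdd (kummerMap k n a)) :
    x = Multiplicative.toAdd (kummerTate k a) := by
  apply (continuousCohomologyOneTateModuleEquiv k).injective
  rw [continuousCohomologyOneTateModuleEquiv_kummerTate]
  exact Subtype.ext (funext fun n => by
    rw [continuousCohomologyOneTateModuleEquiv,
      DiscreteInvSystem.coe_continuousCohomologyOneLimitEquiv_apply, h n, coe_kummerFamily_apply])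

end KummerTate

/-! ### `H¹(α; μ_Ẑ(α))`: the cohomology of the group-theoretic cyclotome along an isomorphism of groups -/

section Congr

variable {G : Type u} [Group G] [TopologicalSpace G] [IsTopologicalGroup G] [CompactSpace G]
  {G' : Type u} [Group G'] [TopologicalSpace G'] [IsTopologicalGroup G'] [CompactSpace G']

/-- `μ_{ℚ/ℤ}(α)` is `α`-equivariant for the conjugation actions (a private copy of abc-iut-w6-d047's
`muQZ.map_smul`, `EtaleTheta/GKCyclotomeJunction.lean`, to keep this L4 file free of [EtTh] imports).
[cite: MochizukiAbsTopIII2015, Cor 1.10 (i) p.42] -/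
private theorem muQZ.map_smul_conj (α : G ≃ₜ* G') (g : G) (z : muQZ G) :
    muQZ.map α (g • z) = α g • muQZ.map α z := by
  rw [muQZ.smul_def, muQZ.smul_def, ← muQZ.map_trans, ← muQZ.map_trans]
  exact muQZ.map_congr (fun x => by simp [map_mul, map_inv]) z

/-- `μ_Ẑ(α)` is `α`-equivariant (private copy of abc-iut-w6-d047's `muZhat.map_smul`).
[cite: MochizukiAbsTopIII2015, Cor 1.10 (i) p.42] -/
private theorem muZhat.map_smul_conj (α : G ≃ₜ* G') (g : G) (ζ : muZhat G) :
    muZhat.map α (g • ζ) = α g • muZhat.map α ζ := by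
  refine Subtype.ext (funext fun n => ?_)
  rw [muZhat.map_apply_coe, muZhat.coe_smul_apply, muZhat.coe_smul_apply, muZhat.map_apply_coe,
    muQZ.toAdd_smul, muQZ.map_smul_conj]
  apply Multiplicative.toAdd.injective
  rw [toAdd_ofAdd, muQZ.toAdd_smul, toAdd_ofAdd]

/-- `μ_Ẑ(α) : μ_Ẑ(G) → μ_Ẑ(G')` on the additive topological carriers `MuZhatMod` (abc-iut-L4-t1,
`CyclotomicSynchronization.lean`), as a continuous `ℤ`-linear map (componentwise `μ_{ℚ/ℤ}(α)` on
discrete components, hence continuous). [cite: MochizukiAbsTopIII2015, Cor 1.10 (i) p.42] -/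
def MuZhatMod.congrL (α : G ≃ₜ* G') : MuZhatMod G →L[ℤ] MuZhatMod G' :=
  { (MonoidHom.toAdditive (muZhat.map α) : Additive (muZhat G) →+ Additive (muZhat G')).toIntLinearMap with
    cont := by
      refine continuous_induced_rng.2 (continuous_pi fun n => ?_)
      exact (continuous_of_discreteTopology (f := fun x : Multiplicative (muQZ G) =>
        Multiplicative.ofAdd (muQZ.map α (Multiplicative.toAdd x)))).comp (MuZhatMod.continuous_apply (G := G) n) }

/-- Formula for `MuZhatMod.congrL`. [cite: MochizukiAbsTopIII2015, Cor 1.10 (i) p.42] -/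
@[simp] theorem MuZhatMod.toMuZhat_congrL (α : G ≃ₜ* G') (m : MuZhatMod G) :
    (MuZhatMod.congrL α m).toMuZhat = muZhat.map α m.toMuZhat :=
  rfl

/-- **`μ_Ẑ(α)` as a morphism of topological `G'`-representations** `res_{α⁻¹} μ_Ẑ(G) ⟶ μ_Ẑ(G')`
(`G'` acting on `μ_Ẑ(G)` through `α⁻¹`): the coefficient morphism over which `H^•(α; μ_Ẑ(α))` is
Mathlib's `ContinuousCohomology.map α⁻¹`. [cite: MochizukiAbsTopIII2015, Cor 1.10 (i) p.42] -/
def galCyclotomeResHom (α : G ≃ₜ* G') :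
    TopRep.res ((α.symm : G' →ₜ* G) : G' →* G) (galCyclotomeTopRep G) ⟶ galCyclotomeTopRep G' :=
  TopRep.ofHom ⟨MuZhatMod.congrL α, fun g' => ContinuousLinearMap.ext fun m => by
    change MuZhatMod.congrL α (MuZhatMod.act G (α.symm g') m) = MuZhatMod.act G' g' (MuZhatMod.congrL α m)
    apply (show Function.Injective (MuZhatMod.toMuZhat (G := G')) from fun _ _ h => h)
    rw [MuZhatMod.toMuZhat_congrL, MuZhatMod.toMuZhat_act, MuZhatMod.toMuZhat_act,
      MuZhatMod.toMuZhat_congrL, muZhat.map_smul_conj, ContinuousMulEquiv.apply_symm_apply]⟩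

/-- **`Hⁿ(α; μ_Ẑ(α)) : Hⁿ(G, μ_Ẑ(G)) → Hⁿ(G', μ_Ẑ(G'))`**, the map induced on the continuous cohomology of
the GROUP-THEORETIC cyclotome by an arbitrary isomorphism of topological groups `α : G ≃ₜ* G'`
(pull-back along `α⁻¹`, coefficients `μ_Ẑ(α)`); «the asserted "functoriality"» of Cor. 1.10 (i) for
isomorphisms. [cite: MochizukiAbsTopIII2015, Cor 1.10 (i) p.42] -/
def galCyclotomeCohomologyMap (α : G ≃ₜ* G') (n : ℕ) :
    continuousCohomology n (galCyclotomeTopRep G) →+ continuousCohomology n (galCyclotomeTopRep G') :=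
  (ContinuousCohomology.map (α.symm : G' →ₜ* G) (galCyclotomeResHom α) n).hom.toLinearMap.toAddMonoidHom

/-- `H¹(α; μ_Ẑ(α)) : H¹(G, μ_Ẑ(G)) → H¹(G', μ_Ẑ(G'))` on abc-iut-L4-t1's `galCyclotomeH1`.
[cite: MochizukiAbsTopIII2015, Cor 1.10 (i) p.42] -/
abbrev galCyclotomeH1Map (α : G ≃ₜ* G') : galCyclotomeH1 G →+ galCyclotomeH1 G' :=
  galCyclotomeCohomologyMap α 1

end Congr

/-! ### The reciprocity map read on the real container -/

section Container

variable {k : Type u} [Field k] [CharZero k]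
  {φ : muQZ (absoluteGaloisGroup k) ≃+ Additive (CommGroup.torsion (AlgebraicClosure k)ˣ)}

/-- **The Kummer map into the REAL container** `kˣ → H¹(G_k, μ_Ẑ(G_k))`: `κ̂` followed by
`H¹(φ)⁻¹ : H¹(G_k, Ẑ(1)) ⥲ H¹(G_k, μ_Ẑ(G_k))` (abc-iut-L4-t11's `galCyclotomeIsoTateModule k φ hφ`), for a
`G_k`-equivariant `φ : μ_{ℚ/ℤ}(G_k) ≅ μ(k̄)` — Cor. 1.10 (ii)(d) «the Kummer map `k^× ↪ H¹(G_k, μ_Ẑ(·))`».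
[cite: MochizukiAbsTopIII2015, Cor 1.10 (ii) p.42] -/
def kummerGalCyclotome
    (hφ : ∀ (σ : absoluteGaloisGroup k) (x : muQZ (absoluteGaloisGroup k)),
      (((Additive.toMul (φ (σ • x)) : CommGroup.torsion (AlgebraicClosure k)ˣ) :
          (AlgebraicClosure k)ˣ) : AlgebraicClosure k) =
        σ • (((Additive.toMul (φ x) : CommGroup.torsion (AlgebraicClosure k)ˣ) :
          (AlgebraicClosure k)ˣ) : AlgebraicClosure k)) :
    kˣ →* Multiplicative (galCyclotomeH1 (absoluteGaloisGroup k)) :=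
  (AddMonoidHom.toMultiplicative
      (cohomologyMap (galCyclotomeIsoTateModule k φ hφ).inv 1).hom.toLinearMap.toAddMonoidHom).comp
    (kummerTate k)

/-- The composite `kˣ —κ̂→ H¹(G_k, Ẑ(1)) —H¹(φ)⁻¹→ H¹(G_k, μ_Ẑ(G_k)) —j→ G_k^ab` for an additive
isomorphism `j : H¹(G_k, μ_Ẑ(G_k)) ≃+ G_k^ab` (the candidate reciprocity map of Cor. 1.10 (i)(b)+(ii)(d)).
[cite: MochizukiAbsTopIII2015, Cor 1.10 (ii) p.42] -/
def reciprocityOfContainerIso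
    (hφ : ∀ (σ : absoluteGaloisGroup k) (x : muQZ (absoluteGaloisGroup k)),
      (((Additive.toMul (φ (σ • x)) : CommGroup.torsion (AlgebraicClosure k)ˣ) :
          (AlgebraicClosure k)ˣ) : AlgebraicClosure k) =
        σ • (((Additive.toMul (φ x) : CommGroup.torsion (AlgebraicClosure k)ˣ) :
          (AlgebraicClosure k)ˣ) : AlgebraicClosure k))
    (j : galCyclotomeH1 (absoluteGaloisGroup k) ≃+ Additive (absoluteGaloisGroupAbelianization k)) :
    kˣ →* absoluteGaloisGroupAbelianization k :=
  (AddEquiv.toMultiplicativeLeft j).toMonoidHom.comp (kummerGalCyclotome hφ)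

end Container

namespace AbsTopIII

/-! ### READING (D): Cor. 1.10 (ii)(d) at the `G_k`-level, strengthened -/

/-- **[AbsTopIII] Cor. 1.10 (ii)(d) STRENGTHENED (reading (D)).**  «One constructs the image of the
Kummer map `k^× ↪ H¹(G_k, μ_Ẑ(·))` … as the inverse image of the subgroup generated by the Frobenius
element via the surjection `H¹(G_k, μ_Ẑ(·)) ⥲ H¹(G_k, μ_Ẑ(G_k)) ⥲ G_k^ab ↠ Ẑ` of (b)» (pp. 42–43),
typed over the REAL container: for every MLF `k` (the tree's valued form) and EVERY `G_k`-equivariant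
`φ : μ_{ℚ/ℤ}(G_k) ≅ μ(k̄)`, there is an additive isomorphism `j : H¹(G_k, μ_Ẑ(G_k)) ≃+ G_k^ab` (the
isomorphism of (i)(b)) such that `j ∘ H¹(φ)⁻¹ ∘ κ̂ : kˣ → G_k^ab` IS a local reciprocity map in the
tree's sense `IsLocalReciprocityMap` (Serre, *Local Fields* XIII §4 / XIV §6: injective; image
`𝔄_k⁰` = the classes inducing an integral power of Frobenius — «the inverse image of the subgroup
generated by the Frobenius element»; `𝒪_kˣ` homeomorphically onto the inertia image; uniformisers to
arithmetic Frobenius).  Consequently the Kummer image of `kˣ` in `H¹(G_k, μ_Ẑ(G_k))` is `j⁻¹(𝔄_k⁰)`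
(print's sentence (d)), that of `𝒪_kˣ` is `j⁻¹(𝔗_k)`.  Not closable by choice (`j` is pinned on the
Kummer image, a copy of `kˣ`). [cite: MochizukiAbsTopIII2015, Cor 1.10 (ii) p.42] -/
def Cor_1_10_ii' : Prop :=
  ∀ (k : Type u) [Field k] [ValuativeRel k] [TopologicalSpace k] [IsNonarchimedeanLocalField k]
    [CharZero k]
    (φ : muQZ (absoluteGaloisGroup k) ≃+ Additive (CommGroup.torsion (AlgebraicClosure k)ˣ))
    (hφ : ∀ (σ : absoluteGaloisGroup k) (x : muQZ (absoluteGaloisGroup k)),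
      (((Additive.toMul (φ (σ • x)) : CommGroup.torsion (AlgebraicClosure k)ˣ) :
          (AlgebraicClosure k)ˣ) : AlgebraicClosure k) =
        σ • (((Additive.toMul (φ x) : CommGroup.torsion (AlgebraicClosure k)ˣ) :
          (AlgebraicClosure k)ˣ) : AlgebraicClosure k)),
    ∃ j : galCyclotomeH1 (absoluteGaloisGroup k) ≃+ Additive (absoluteGaloisGroupAbelianization k),
      IsLocalReciprocityMap k (reciprocityOfContainerIso hφ j)

/-! ### READING (N): Cor. 1.10 (i)(b) as a NATURAL isomorphism («functorial group-theoretic algorithm») -/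

/-- **[AbsTopIII] Cor. 1.10 (i)(b), NATURAL form (reading (N)).**  «There exists a functorial
"group-theoretic" algorithm for reconstructing … the natural surjection
`H¹(G_k, μ_Ẑ(G_k)) ⥲ G_k^ab ↠ Ẑ` … from the profinite group `G_k` … the asserted "functoriality" is with
respect to arbitrary injective open homomorphisms of profinite groups» (pp. 41–42) — the part
"isomorphisms", in the cell's bi-anabelian (U)-shape: there is ONE family of additive isomorphisms
`j_k : H¹(G_k, μ_Ẑ(G_k)) ≃+ G_k^ab`, indexed by the MLFs `k : Type` (valued form), such that
(1) every `j_k` is the isomorphism of (i)(b)+(ii)(d) — for SOME `G_k`-equivariant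
`φ : μ_{ℚ/ℤ}(G_k) ≅ μ(k̄)` the composite `j_k ∘ H¹(φ)⁻¹ ∘ κ̂` is a local reciprocity map (reading (D));
(2) NATURALITY: for EVERY isomorphism of topological groups `α : G_{k₁} ≃ₜ* G_{k₂}` (geometric or not,
cf. Rmk. 1.9.4) the square commutes: `j_{k₂} (H¹(α; μ_Ẑ(α)) x) = α^ab (j_{k₁} x)` for all
`x ∈ H¹(G_{k₁}, μ_Ẑ(G_{k₁}))`, where `H¹(α; μ_Ẑ(α))` = `galCyclotomeH1Map α` and `α^ab` is `α` on the
topological abelianizations.  Not closable by choice (quantifies over all abstract `α`); with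
[AbsAnab] Prop. 1.2.1 (iii) (`galoisMLF_iso_unitImage_holds`) it makes the Kummer image `j_k⁻¹(𝔄_k⁰)`
an invariant of the profinite group `G_k`.  Universe `0` (the units transport of [AbsAnab] Prop. 1.2.1
(vi)/(vii), `Prop121vii.unitsTransport_holds`, is proved at `Type`). [cite: MochizukiAbsTopIII2015, Cor 1.10 (i) p.42] -/
def Cor_1_10_i_b_natural : Prop :=
  ∃ j : ∀ (k : Type) [Field k] [ValuativeRel k] [TopologicalSpace k] [IsNonarchimedeanLocalField k]
      [CharZero k],
      galCyclotomeH1 (absoluteGaloisGroup k) ≃+ Additive (absoluteGaloisGroupAbelianization k),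
    (∀ (k : Type) [Field k] [ValuativeRel k] [TopologicalSpace k] [IsNonarchimedeanLocalField k]
      [CharZero k],
      ∃ (φ : muQZ (absoluteGaloisGroup k) ≃+ Additive (CommGroup.torsion (AlgebraicClosure k)ˣ))
        (hφ : ∀ (σ : absoluteGaloisGroup k) (x : muQZ (absoluteGaloisGroup k)),
          (((Additive.toMul (φ (σ • x)) : CommGroup.torsion (AlgebraicClosure k)ˣ) :
              (AlgebraicClosure k)ˣ) : AlgebraicClosure k) =
            σ • (((Additive.toMul (φ x) : CommGroup.torsion (AlgebraicClosure k)ˣ) :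
              (AlgebraicClosure k)ˣ) : AlgebraicClosure k)),
        IsLocalReciprocityMap k (reciprocityOfContainerIso hφ (j k))) ∧
    ∀ (k₁ : Type) [Field k₁] [ValuativeRel k₁] [TopologicalSpace k₁] [IsNonarchimedeanLocalField k₁]
      [CharZero k₁]
      (k₂ : Type) [Field k₂] [ValuativeRel k₂] [TopologicalSpace k₂] [IsNonarchimedeanLocalField k₂]
      [CharZero k₂]
      (α : absoluteGaloisGroup k₁ ≃ₜ* absoluteGaloisGroup k₂) (x : galCyclotomeH1 (absoluteGaloisGroup k₁)),
      j k₂ (galCyclotomeH1Map α x) = Additive.ofMul (abelianizationCongr α (Additive.toMul (j k₁ x)))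

end AbsTopIII

end Literature.AnabelianGeometry.AbsoluteAnabelian
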